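/-
Copyright (c) 2026. Released under the Apache 2.0 license.

# The Petersen graph in the ϑ-hierarchy: `ϑ(P) = α(P) = 4 < 5 = χ(P̄)`, `ϑ-rank(P) = 0`

Literature anchor (engines group, SDP-3 idle lane; shared numerical engines serving client
cells — rigour lives in the verifiers; every published number belongs to a client cell's
ledger, not to the engines group).

Lovász (1979, Theorem 13 and Corollary 6, p. 6) computed `ϑ(K(n,r)) = C(n-1, r-1)` for the Kneser
graphs and in particular `ϑ(Petersen) = ϑ(K(5,2)) = 4` ("the Petersen graph, which is isomorphic
with K(5,2), has capacity four").  Brouwer–Haemers (2012, §3.5 after Theorem 3.5.2, and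
Proposition 3.7.5) record the same through the Hoffman/ratio bound: the Petersen graph has
spectrum `3¹ 1⁵ (-2)⁴`, independence number `4`, and `α(Γ) = ϑ(Γ) = 4`, the dual witness being
`M = J - (n/(k - θ_n)) A = J - 2A`.  Laurent–Vargas (2022, §1, p. 3) point out the consequence
for the de Klerk–Pasechnik hierarchy: "every graph satisfying `ϑ(G) = α(G)` also has `ϑ`-rank
0; this is the case, e.g., for the Petersen graph".  Since the Petersen graph is triangle-free
on ten vertices, its complement has chromatic number `5 > 4`: the semidefinite bound is exact
although the clique-cover bound of the sandwich theorem is not — in contrast with the perfect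
graphs of `DeKlerkPasechnikThetaRank` (rank 0 *because* `χ(Ḡ) = α(G)`).

Over the tree's `lovaszTheta`, `theta` (`ϑ^{(r)}`) and `thetaRank` we give:

* `petersen : SimpleGraph (Fin 10)` (outer pentagon, spokes, inner pentagram), `3`-regular and
  triangle-free; the Kneser graphs `kneser n r` and the isomorphism
  `petersenIsoKneser : petersen ≃g kneser 5 2`; vertex-transitivity
  (`isVertexTransitive_petersen`);
* invariance of `ϑ` under isomorphism (`lovaszTheta_iso`, with the transport lemmas
  `isThetaFeasible_submatrix`, `entrySum_submatrix`);
* the Hoffman–Lovász dual witness `dualA = J - 2A` with `4I - dualA ⪰ 0`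
  (`posSemidef_four_sub_dualA`, via the explicit identity `N² = 6N` for `N = 4I - J + 2A`), hence
  `ϑ(P) ≤ 4` (`lovaszTheta_petersen_le`);
* `α(P) = 4` (`indepNum_petersen`), **`ϑ(P) = 4`** (`lovaszTheta_petersen`), `ϑ^{(r)}(P) = 4` for
  every `r` (`theta_petersen`), **`ϑ-rank(P) = 0`** (`thetaRank_petersen`), and the Kneser forms
  `lovaszTheta_kneser_five_two`, `indepNum_kneser_five_two` (Lovász's Theorem 13 / Corollary 7 at
  `(n,r) = (5,2)`);
* the complement: `χ(P̄) = 5` (`chromaticNumber_petersen_compl`), so `ϑ(P) < χ(P̄)`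
  (`lovaszTheta_petersen_lt_of_colorable`); `ϑ(P̄) = 5/2` (`lovaszTheta_petersen_compl`, from the
  tree's `ϑ(G)ϑ(Ḡ) = n` for vertex-transitive `G`), `α(P̄) = 2` and hence `α(P̄) < ϑ(P̄)`
  (`indepNum_lt_lovaszTheta_petersen_compl`).

All matrix identities are explicit computations on `Fin 10`.
-/
import Mathlib
import Literature.Combinatorics.Optimization.DeKlerkPasechnikLovaszTheta
import Literature.Combinatorics.Optimization.DeKlerkPasechnikThetaRank
import HarnessLib

noncomputable section

namespace Literature.Combinatorics.Optimization.PetersenTheta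

open Matrix Finset _root_.SimpleGraph
open Literature.Combinatorics.SimpleGraph
open Literature.Algebra.Polynomial.ParriloCopositiveSos
open Literature.Combinatorics.Optimization.MotzkinStrausCopositive
open Literature.Combinatorics.Optimization.DeKlerkPasechnikTheta
open Literature.Combinatorics.Optimization.DeKlerkPasechnikThetaDual
open Literature.Combinatorics.Optimization.DeKlerkPasechnikLovaszTheta
open Literature.Combinatorics.Optimization.DeKlerkPasechnikThetaRank

/-! ### `ϑ` is invariant under graph isomorphism -/

section Iso

variable {V W : Type*} [Fintype V] [Fintype W] {G : SimpleGraph V} {H : SimpleGraph W}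

/-- Transport of Lovász-feasible matrices along an isomorphism `φ : G ≃g H`:
`B ↦ B.submatrix φ φ` (`ϑ` is a graph invariant; Lovász 1979, p. 2). [cite: Lovasz1979, p. 2
(definition of ϑ via orthonormal representations; a graph invariant)] -/
theorem isThetaFeasible_submatrix {B : Matrix W W ℝ} (hB : IsThetaFeasible H B) (φ : G ≃g H) :
    IsThetaFeasible G (B.submatrix φ φ) where
  posSemidef := hB.posSemidef.submatrix _
  trace_eq_one := by
    rw [← hB.trace_eq_one]
    simp only [Matrix.trace, Matrix.diag, submatrix_apply]
    exact φ.toEquiv.sum_comp (fun w => B w w)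
  apply_eq_zero u v huv := hB.apply_eq_zero (φ.map_adj_iff.2 huv)

/-- The objective `Σ_{u,v} B_{uv}` is invariant under simultaneous relabelling by a bijection.
[cite: Lovasz1979, p. 2 (definition of ϑ)] -/
theorem entrySum_submatrix (B : Matrix W W ℝ) (e : V ≃ W) :
    entrySum (B.submatrix e e) = entrySum B := by
  unfold entrySum
  simp only [submatrix_apply]
  rw [e.sum_comp (fun u => ∑ v, B u (e v))]
  exact sum_congr rfl fun u _ => e.sum_comp (fun v => B u v)

/-- `ϑ(H) ≤ ϑ(G)` along an isomorphism `G ≃g H` (and hence equality, `lovaszTheta_iso`).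
[cite: Lovasz1979, p. 2 (definition of ϑ)] -/
theorem lovaszTheta_le_of_iso (φ : G ≃g H) : lovaszTheta H ≤ lovaszTheta G := by
  classical
  by_cases hne : (entrySum '' {B | IsThetaFeasible H B}).Nonempty
  · refine csSup_le hne ?_
    rintro _ ⟨B, hB, rfl⟩
    rw [← entrySum_submatrix B φ.toEquiv]
    exact le_csSup (bddAbove_thetaValues G) ⟨_, isThetaFeasible_submatrix hB φ, rfl⟩
  · rw [Set.not_nonempty_iff_eq_empty] at hne
    rw [lovaszTheta, hne, Real.sSup_empty]
    exact lovaszTheta_nonneg G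

/-- **`ϑ` is a graph invariant**: `G ≃g H → ϑ(G) = ϑ(H)`.
[cite: Lovasz1979, p. 2 (definition of ϑ)] -/
theorem lovaszTheta_iso (φ : G ≃g H) : lovaszTheta G = lovaszTheta H :=
  le_antisymm (lovaszTheta_le_of_iso φ.symm) (lovaszTheta_le_of_iso φ)

end Iso

/-! ### The Petersen graph and the Kneser graph `K(5,2)` -/

/-- Generating relation of the standard drawing: outer pentagon `i → i+1`, spokes `i → i+5`,
inner pentagram `5+i → 5+(i+2)` (indices mod 5). [folklore] -/
@[folklore] private def petersenRel (i j : Fin 10) : Prop :=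
  (i.val < 5 ∧ j.val < 5 ∧ j.val = (i.val + 1) % 5) ∨ (i.val < 5 ∧ j.val = i.val + 5) ∨
    (5 ≤ i.val ∧ 5 ≤ j.val ∧ j.val - 5 = (i.val - 5 + 2) % 5)

/-- the generating relation is decidable [folklore] -/
@[folklore] private instance : DecidableRel petersenRel := fun i j => by
  unfold petersenRel; infer_instance

/-- **The Petersen graph** on `Fin 10`: outer pentagon `0–1–2–3–4`, spokes `i ~ i+5`, inner
pentagram `5–7–9–6–8` (the symmetrised generating relation); the strongly regular graph with
parameters `(10, 3, 0, 1)`, isomorphic to the Kneser graph `K(5,2)` (`petersenIsoKneser`).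
[cite: BrouwerHaemers2012, §9.1.1 (iv) (parameters (10,3,0,1)) and §9.1.7 (ii) (complement of
T(5))]
[cite: Lovasz1979, Corollary 6 (p. 6)] -/
def petersen : SimpleGraph (Fin 10) := SimpleGraph.fromRel petersenRel

/-- Adjacency in the Petersen graph is decidable (explicit relation on `Fin 10`).
[cite: BrouwerHaemers2012, §9.1.1 (iv)] -/
instance : DecidableRel petersen.Adj := by unfold petersen; infer_instance

/-- The Petersen graph is `3`-regular. [cite: BrouwerHaemers2012, §9.1.1 (iv) (k = 3)] -/
theorem petersen_isRegularOfDegree : petersen.IsRegularOfDegree 3 := by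
  intro v
  revert v
  decide

/-- The Petersen graph is triangle-free (`λ = 0` in the parameters `(10,3,0,1)`).
[cite: BrouwerHaemers2012, §9.1.1 (iv) (λ = 0)] -/
theorem petersen_cliqueFree_three : petersen.CliqueFree 3 := by
  have key : ∀ a b c : Fin 10, petersen.Adj a b → petersen.Adj a c → petersen.Adj b c → False := by
    decide
  intro s hs
  obtain ⟨a, b, c, hab, hac, hbc, rfl⟩ := card_eq_three.1 hs.card_eq
  exact key a b c (hs.1 (by simp) (by simp) hab) (hs.1 (by simp) (by simp) hac)
    (hs.1 (by simp) (by simp) hbc)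

/-- **The Kneser graph `K(n,r)`**: vertices the `r`-subsets of an `n`-set, adjacent iff disjoint
(Lovász 1979, Theorem 13). [cite: Lovasz1979, Theorem 13 (p. 6: definition of K(n,r))] -/
def kneser (n r : ℕ) : SimpleGraph {s : Finset (Fin n) // s.card = r} :=
  SimpleGraph.fromRel fun s t => Disjoint s.1 t.1

/-- Adjacency in `K(n,r)` is decidable. [cite: Lovasz1979, Theorem 13 (p. 6)] -/
instance (n r : ℕ) : DecidableRel (kneser n r).Adj := by unfold kneser; infer_instance

/-- For `r ≠ 0`, `K(n,r).Adj s t ↔ Disjoint s t` (distinctness is automatic).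
[cite: Lovasz1979, Theorem 13 (p. 6)] -/
theorem kneser_adj {n r : ℕ} (hr : r ≠ 0) (s t : {s : Finset (Fin n) // s.card = r}) :
    (kneser n r).Adj s t ↔ Disjoint s.1 t.1 := by
  rw [kneser, SimpleGraph.fromRel_adj]
  constructor
  · rintro ⟨-, h | h⟩
    · exact h
    · exact h.symm
  · intro h
    refine ⟨fun hst => ?_, Or.inl h⟩
    subst hst
    have h0 : s.1 = ∅ := (Finset.disjoint_self_iff_empty _).1 h
    exact hr (by rw [← s.2, h0, Finset.card_empty])

/-- The labelling `Fin 10 → 2`-subsets of `Fin 5`: outer `i ↦ {2i, 2i+1}`, inner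
`5+i ↦ {2i+2, 2i+4}` (mod 5). [folklore] -/
@[folklore] private def toPair : Fin 10 → Finset (Fin 5) :=
  ![{0, 1}, {2, 3}, {4, 0}, {1, 2}, {3, 4}, {2, 4}, {4, 1}, {1, 3}, {3, 0}, {0, 2}]

/-- each label is a `2`-set [folklore] -/
@[folklore] private theorem toPair_card (v : Fin 10) : (toPair v).card = 2 := by
  fin_cases v <;> rfl

/-- the labelling as a map to the vertex type of `K(5,2)` [folklore] -/
@[folklore] private def toVertex (v : Fin 10) : {s : Finset (Fin 5) // s.card = 2} :=
  ⟨toPair v, toPair_card v⟩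

/-- the labelling is injective [folklore] -/
@[folklore] private theorem toVertex_injective : Function.Injective toVertex := by
  intro a b h
  have h' : toPair a = toPair b := congrArg Subtype.val h
  revert a b
  decide

/-- there are ten `2`-subsets of a `5`-set [folklore] -/
@[folklore] private theorem card_pairs : Fintype.card {s : Finset (Fin 5) // s.card = 2} = 10 := by
  rw [Fintype.card_subtype]; rfl

/-- the labelling is bijective [folklore] -/
@[folklore] private theorem toVertex_bijective : Function.Bijective toVertex := by
  rw [Fintype.bijective_iff_injective_and_card, card_pairs]
  exact ⟨toVertex_injective, by simp⟩

/-- the labelling preserves adjacency [folklore] -/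
@[folklore] private theorem kneser_adj_toVertex (a b : Fin 10) :
    (kneser 5 2).Adj (toVertex a) (toVertex b) ↔ petersen.Adj a b := by
  revert a b
  decide

/-- **The Petersen graph is isomorphic with `K(5,2)`** (Lovász 1979, Corollary 6), by the
explicit labelling outer `i ↦ {2i, 2i+1}`, inner `5+i ↦ {2i+2, 2i+4}`.
[cite: Lovasz1979, Corollary 6 (p. 6)] [cite: BrouwerHaemers2012, §9.1.7 (ii)] -/
def petersenIsoKneser : petersen ≃g kneser 5 2 where
  toEquiv := Equiv.ofBijective toVertex toVertex_bijective
  map_rel_iff' := by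
    intro a b
    exact kneser_adj_toVertex a b

/-! ### Automorphisms: the Petersen graph is vertex-transitive -/

/-- rotation of both pentagons [folklore] -/
@[folklore] private def rot : Fin 10 ≃ Fin 10 where
  toFun := ![1, 2, 3, 4, 0, 6, 7, 8, 9, 5]
  invFun := ![4, 0, 1, 2, 3, 9, 5, 6, 7, 8]
  left_inv := by intro v; fin_cases v <;> rfl
  right_inv := by intro v; fin_cases v <;> rfl

/-- exchange of the outer pentagon and the inner pentagram: `i ↦ 5 + 2i`, `5+i ↦ 2i` (mod 5)
[folklore] -/
@[folklore] private def swap : Fin 10 ≃ Fin 10 where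
  toFun := ![5, 7, 9, 6, 8, 0, 2, 4, 1, 3]
  invFun := ![5, 8, 6, 9, 7, 0, 3, 1, 4, 2]
  left_inv := by intro v; fin_cases v <;> rfl
  right_inv := by intro v; fin_cases v <;> rfl

/-- the rotation is an automorphism [folklore] -/
@[folklore] private def rotIso : petersen ≃g petersen where
  toEquiv := rot
  map_rel_iff' := by
    have key : ∀ a b : Fin 10, petersen.Adj (rot a) (rot b) ↔ petersen.Adj a b := by decide
    intro a b
    exact key a b

/-- the exchange is an automorphism [folklore] -/
@[folklore] private def swapIso : petersen ≃g petersen where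
  toEquiv := swap
  map_rel_iff' := by
    have key : ∀ a b : Fin 10, petersen.Adj (swap a) (swap b) ↔ petersen.Adj a b := by decide
    intro a b
    exact key a b

/-- every vertex is the image of `0` under an automorphism [folklore] -/
@[folklore] private theorem exists_iso_apply_zero (u : Fin 10) :
    ∃ φ : petersen ≃g petersen, φ 0 = u := by
  fin_cases u
  · exact ⟨RelIso.refl _, rfl⟩
  · exact ⟨rotIso, by decide⟩
  · exact ⟨rotIso.trans rotIso, by decide⟩
  · exact ⟨(rotIso.trans rotIso).trans rotIso, by decide⟩
  · exact ⟨((rotIso.trans rotIso).trans rotIso).trans rotIso, by decide⟩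
  · exact ⟨swapIso, by decide⟩
  · exact ⟨((rotIso.trans rotIso).trans rotIso).trans swapIso, by decide⟩
  · exact ⟨rotIso.trans swapIso, by decide⟩
  · exact ⟨(((rotIso.trans rotIso).trans rotIso).trans rotIso).trans swapIso, by decide⟩
  · exact ⟨(rotIso.trans rotIso).trans swapIso, by decide⟩

/-- **The Petersen graph is vertex-transitive** (rotations and the outer/inner exchange), in the
tree's sense `IsVertexTransitive` of Lovász 1979, Theorem 8. [cite: Lovasz1979, Theorem 8 (p. 5)
and Corollary 6 (p. 6)] [cite: BrouwerHaemers2012, Proposition 3.7.6] -/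
theorem isVertexTransitive_petersen : IsVertexTransitive petersen := fun u v => by
  obtain ⟨φ, hφ⟩ := exists_iso_apply_zero u
  obtain ⟨ψ, hψ⟩ := exists_iso_apply_zero v
  subst hφ hψ
  exact ⟨φ.symm.trans ψ, by simp⟩

/-! ### The Hoffman–Lovász dual witness `J - 2A` -/

/-- **The dual witness** `A = J - 2A_P` of Brouwer–Haemers, Proposition 3.7.5
(`M = J - (n/(k-θ_n)) A_Γ` with `n = 10`, `k = 3`, `θ_n = -2`): entries `1` off the edges, `-1` on
the edges; a Knuth dual feasible matrix. [cite: BrouwerHaemers2012, Proposition 3.7.5 (proof)]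
[cite: Knuth1994, §6 (6.1)] -/
def dualA : Matrix (Fin 10) (Fin 10) ℝ := of fun i j => if petersen.Adj i j then -1 else 1

/-- `N = 4I - (J - 2A_P)`, written out [folklore] -/
@[folklore] private def dualN : Matrix (Fin 10) (Fin 10) ℝ :=
  !![3, 1, -1, -1, 1, 1, -1, -1, -1, -1;
     1, 3, 1, -1, -1, -1, 1, -1, -1, -1;
     -1, 1, 3, 1, -1, -1, -1, 1, -1, -1;
     -1, -1, 1, 3, 1, -1, -1, -1, 1, -1;
     1, -1, -1, 1, 3, -1, -1, -1, -1, 1;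
     1, -1, -1, -1, -1, 3, -1, 1, 1, -1;
     -1, 1, -1, -1, -1, -1, 3, -1, 1, 1;
     -1, -1, 1, -1, -1, 1, -1, 3, -1, 1;
     -1, -1, -1, 1, -1, 1, 1, -1, 3, -1;
     -1, -1, -1, -1, 1, -1, 1, 1, -1, 3]

/-- `N = 4I - dualA` [folklore] -/
@[folklore] private theorem dualN_eq :
    dualN = (4 : ℝ) • (1 : Matrix (Fin 10) (Fin 10) ℝ) - dualA := by
  ext i j
  simp only [dualA, Matrix.sub_apply, Matrix.smul_apply, Matrix.one_apply, of_apply, smul_eq_mul]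
  fin_cases i <;> fin_cases j <;> simp +decide [dualN] <;> norm_num

/-- **`N² = 6N`** for `N = 4I - J + 2A_P`: `N` is `6` times the orthogonal projection onto the
`θ = 1` eigenspace of the Petersen graph (spectrum `3¹ 1⁵ (-2)⁴`), computed entrywise.
[cite: BrouwerHaemers2012, §3.5 (after Theorem 3.5.2: spectrum of the Petersen graph)] -/
theorem dualN_mul_self :
    ((4 : ℝ) • (1 : Matrix (Fin 10) (Fin 10) ℝ) - dualA) * ((4 : ℝ) • 1 - dualA) =
      (6 : ℝ) • ((4 : ℝ) • 1 - dualA) := by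
  rw [← dualN_eq]
  ext i j
  fin_cases i <;> fin_cases j <;> norm_num [Matrix.mul_apply, Fin.sum_univ_succ, dualN]

/-- `N` is symmetric [folklore] -/
@[folklore] private theorem dualN_conjTranspose : dualNᴴ = dualN := by
  ext i j
  rw [conjTranspose_apply, star_trivial]
  fin_cases i <;> fin_cases j <;> rfl

/-- `J - 2A_P` is Knuth dual feasible for the Petersen graph: symmetric, `= 1` off the edges.
[cite: Knuth1994, §6 (6.1)] [cite: BrouwerHaemers2012, Proposition 3.7.5] -/
theorem isThetaDualFeasible_dualA : IsThetaDualFeasible petersen dualA where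
  isHermitian := by
    ext i j
    simp only [dualA, conjTranspose_apply, of_apply, star_trivial, petersen.adj_comm i j]
  apply_eq_one u v h := by simp [dualA, h]

/-- **`4I - (J - 2A_P) ⪰ 0`**, i.e. `Λ(J - 2A_P) ≤ 4`: from `N² = 6N` and `Nᵀ = N`,
`N = (1/6) NᵀN ⪰ 0`. [cite: BrouwerHaemers2012, Proposition 3.7.5 (θ₁(M) = -nθ_n/(k-θ_n) = 4)] -/
theorem posSemidef_four_sub_dualA :
    ((4 : ℝ) • (1 : Matrix (Fin 10) (Fin 10) ℝ) - dualA).PosSemidef := by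
  have h := posSemidef_conjTranspose_mul_self dualN
  rw [dualN_conjTranspose, dualN_eq, dualN_mul_self] at h
  have h' := h.smul (show (0 : ℝ) ≤ 1 / 6 by norm_num)
  rwa [smul_smul, show (1 / 6 : ℝ) * 6 = 1 by norm_num, one_smul] at h'

/-- **`ϑ(P) ≤ 4`** by weak duality (`lovaszTheta_le_of_dual`) with the witness `J - 2A_P`:
the Hoffman/ratio bound `-nθ_n/(k - θ_n) = 20/5 = 4`. [cite: BrouwerHaemers2012, Proposition
3.7.5] [cite: Lovasz1979, Theorem 9 (p. 5: regular graphs), Corollary 3 (p. 4: Hoffman's bound)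
and Corollary 6 (p. 6)] -/
theorem lovaszTheta_petersen_le : lovaszTheta petersen ≤ 4 :=
  lovaszTheta_le_of_dual isThetaDualFeasible_dualA posSemidef_four_sub_dualA (by norm_num)

/-! ### `α(P) = ϑ^{(r)}(P) = ϑ(P) = 4` and `ϑ`-rank `0` -/

/-- the independent set `{0, 2, 8, 9}` [folklore] -/
@[folklore] private def indepFour : Finset (Fin 10) := {0, 2, 8, 9}

/-- `{0, 2, 8, 9}` is an independent `4`-set [folklore] -/
@[folklore] private theorem isNIndepSet_indepFour : petersen.IsNIndepSet 4 indepFour :=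
  (isNClique_compl petersen).1 (by decide)

/-- `4 ≤ α(P)` (the independent set `{0, 2, 8, 9}`; in `K(5,2)`: the four pairs through a
point). [cite: Lovasz1979, Corollary 7 (p. 6: α(K(n,r)) = C(n-1,r-1))]
[cite: BrouwerHaemers2012, §3.5 (independence number of the Petersen graph is 4)] -/
theorem four_le_indepNum_petersen : 4 ≤ petersen.indepNum := by
  have h := isNIndepSet_indepFour.1.card_le_indepNum
  have hc : indepFour.card = 4 := by decide
  rwa [hc] at h

/-- **`α(P) = 4`**: `≥` by `{0,2,8,9}`, `≤` from `α ≤ ϑ^{(0)} ≤ ϑ ≤ 4` (the Hoffman bound is tight).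
[cite: BrouwerHaemers2012, §3.5 (after Theorem 3.5.2)] [cite: Lovasz1979, Corollary 7 (p. 6)] -/
theorem indepNum_petersen : petersen.indepNum = 4 := by
  refine le_antisymm ?_ four_le_indepNum_petersen
  have h : (petersen.indepNum : ℝ) ≤ 4 :=
    ((indepNum_le_theta petersen 0).trans (theta_le_lovaszTheta petersen 0)).trans
      lovaszTheta_petersen_le
  exact_mod_cast h

/-- **Lovász 1979, Corollary 6: `ϑ(Petersen) = 4`.** [cite: Lovasz1979, Corollary 6 (p. 6) and
Theorem 13] [cite: BrouwerHaemers2012, Proposition 3.7.5 (α(Γ) = ϑ(Γ) = 4 for the Petersen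
graph)] -/
theorem lovaszTheta_petersen : lovaszTheta petersen = 4 := by
  refine le_antisymm lovaszTheta_petersen_le ?_
  have h := (indepNum_le_theta petersen 0).trans (theta_le_lovaszTheta petersen 0)
  rw [indepNum_petersen] at h
  exact_mod_cast h

/-- **`ϑ^{(r)}(P) = 4` for every `r`**: the whole de Klerk–Pasechnik hierarchy is exact at once,
squeezed between `α(P) = 4` and `ϑ(P) = 4`. [cite: LaurentVargas2022, §1 (p. 3: "every graph
satisfying ϑ(G) = α(G) also has ϑ-rank 0 … e.g. the Petersen graph")] -/
theorem theta_petersen (r : ℕ) : theta petersen r = 4 := by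
  refine le_antisymm ((theta_le_lovaszTheta petersen r).trans lovaszTheta_petersen_le) ?_
  have h := indepNum_le_theta petersen r
  rw [indepNum_petersen] at h
  exact_mod_cast h

/-- `ϑ^{(r)}(P) = α(P)` for every `r`. [cite: LaurentVargas2022, §1 (p. 3)] -/
theorem theta_petersen_eq_indepNum (r : ℕ) : theta petersen r = petersen.indepNum := by
  rw [theta_petersen, indepNum_petersen]; norm_num

/-- **The Petersen graph has `ϑ`-rank `0`** (Laurent–Vargas 2022, §1), although `χ(P̄) = 5 > α(P)`
(`chromaticNumber_petersen_compl`): rank `0` without the clique-cover certificate of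
`thetaRank_eq_zero_of_colorable`. [cite: LaurentVargas2022, §1 (p. 3)] -/
theorem thetaRank_petersen : thetaRank petersen = 0 :=
  Nat.le_zero.1 (thetaRank_le_of_eq petersen (theta_petersen_eq_indepNum 0))

/-- **Lovász 1979, Theorem 13 at `(n,r) = (5,2)`: `ϑ(K(5,2)) = C(4,1) = 4`.**
[cite: Lovasz1979, Theorem 13 (p. 6)] -/
theorem lovaszTheta_kneser_five_two : lovaszTheta (kneser 5 2) = 4 := by
  rw [← lovaszTheta_iso petersenIsoKneser, lovaszTheta_petersen]

/-- the four pairs through `0` [folklore] -/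
@[folklore] private def starPairs : Finset {s : Finset (Fin 5) // s.card = 2} :=
  {toVertex 0, toVertex 2, toVertex 8, toVertex 9}

/-- the four pairs through `0` form an independent `4`-set of `K(5,2)` [folklore] -/
@[folklore] private theorem isNIndepSet_starPairs : (kneser 5 2).IsNIndepSet 4 starPairs :=
  (isNClique_compl (kneser 5 2)).1 (by decide)

/-- `K(5,2)` has a nonempty vertex type [folklore] -/
@[folklore] private instance : Nonempty {s : Finset (Fin 5) // s.card = 2} := ⟨toVertex 0⟩

/-- **Erdős–Ko–Rado at `(5,2)` (Lovász 1979, Corollary 7): `α(K(5,2)) = C(4,1) = 4`**, the upper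
bound read off `ϑ(K(5,2)) = 4`. [cite: Lovasz1979, Corollary 7 (p. 6)] -/
theorem indepNum_kneser_five_two : (kneser 5 2).indepNum = 4 := by
  classical
  refine le_antisymm ?_ ?_
  · have h : ((kneser 5 2).indepNum : ℝ) ≤ 4 :=
      ((indepNum_le_theta (kneser 5 2) 0).trans (theta_le_lovaszTheta (kneser 5 2) 0)).trans
        lovaszTheta_kneser_five_two.le
    exact_mod_cast h
  · have h := isNIndepSet_starPairs.1.card_le_indepNum
    have hc : starPairs.card = 4 := by decide
    rwa [hc] at h

/-! ### The complement: `χ(P̄) = 5`, `ϑ(P̄) = 5/2 > 2 = α(P̄)` -/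

/-- `P̄` is `5`-colourable: colour `v ↦ v mod 5` (the five spokes are edges of `P`, i.e. a clique
cover of `P` by `5` edges). [cite: BrouwerHaemers2012, §9.1.1 (iv)] -/
theorem petersen_compl_colorable_five : petersenᶜ.Colorable 5 := by
  have key : ∀ u v : Fin 10, petersenᶜ.Adj u v →
      (⟨u.val % 5, Nat.mod_lt _ (by norm_num)⟩ : Fin 5) ≠
        ⟨v.val % 5, Nat.mod_lt _ (by norm_num)⟩ := by
    decide
  exact ⟨Coloring.mk _ (fun {u v} h => key u v h)⟩

/-- `P̄` is not `4`-colourable: a colour class of `P̄` is a clique of the triangle-free `P`, so has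
at most two vertices, and `4 · 2 < 10`. [cite: BrouwerHaemers2012, §9.1.1 (iv) (λ = 0)] -/
theorem not_petersen_compl_colorable_four : ¬ petersenᶜ.Colorable 4 := by
  rintro ⟨C⟩
  obtain ⟨c, hc⟩ := Fintype.exists_lt_card_fiber_of_mul_lt_card (f := fun v => C v) (n := 2)
    (by simp)
  obtain ⟨x, y, z, hx, hy, hz, hxy, hxz, hyz⟩ := two_lt_card_iff.1 hc
  simp only [mem_filter, mem_univ, true_and] at hx hy hz
  have key : ∀ {u v : Fin 10}, u ≠ v → C u = C v → petersen.Adj u v := fun {u v} huv h => by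
    by_contra hadj
    exact C.valid ((compl_adj _ _ _).2 ⟨huv, hadj⟩) h
  have tri : ∀ a b c : Fin 10,
      petersen.Adj a b → petersen.Adj a c → petersen.Adj b c → False := by
    decide
  exact tri x y z (key hxy (hx.trans hy.symm)) (key hxz (hx.trans hz.symm))
    (key hyz (hy.trans hz.symm))

/-- **`χ(P̄) = 5`** (the clique cover number of the Petersen graph). [cite: BrouwerHaemers2012,
§9.1.1 (iv) and Theorem 3.7.4 ("Sandwich": α ≤ ϑ ≤ χ(Ḡ))] -/
theorem chromaticNumber_petersen_compl : petersenᶜ.chromaticNumber = 5 := by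
  refine le_antisymm petersen_compl_colorable_five.chromaticNumber_le ?_
  by_contra h
  have h4 : petersenᶜ.chromaticNumber ≤ 4 := by
    have h' : petersenᶜ.chromaticNumber < 4 + 1 := not_le.1 h
    exact Order.le_of_lt_add_one h'
  exact not_petersen_compl_colorable_four (chromaticNumber_le_iff_colorable.1 h4)

/-- **The sandwich is strict on the right for the Petersen graph**: `ϑ(P) = 4 < k` for every
`k`-colouring of `P̄` (so `α(P) = ϑ(P) = 4 < 5 = χ(P̄)`). [cite: BrouwerHaemers2012, Theorem 3.7.4
("Sandwich") and Proposition 3.7.5] [cite: Lovasz1979, Corollary 6 (p. 6)] -/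
theorem lovaszTheta_petersen_lt_of_colorable {k : ℕ} (hk : petersenᶜ.Colorable k) :
    lovaszTheta petersen < k := by
  rw [lovaszTheta_petersen]
  have h5 : 5 ≤ k := by
    by_contra h
    exact not_petersen_compl_colorable_four (hk.mono (by omega))
  exact_mod_cast h5

/-- **`ϑ(P̄) = 5/2`**: from the tree's `ϑ(G) ϑ(Ḡ) = n` for vertex-transitive `G`
(Lovász 1979, Theorem 8) and `ϑ(P) = 4`. [cite: Lovasz1979, Theorem 8 (p. 5)]
[cite: BrouwerHaemers2012, Proposition 3.7.6] -/
theorem lovaszTheta_petersen_compl : lovaszTheta petersenᶜ = 5 / 2 := by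
  have hprod := lovaszTheta_mul_lovaszTheta_compl_eq_card isVertexTransitive_petersen
  simp only [Fintype.card_fin, Nat.cast_ofNat, lovaszTheta_petersen] at hprod
  linarith

/-- the edge `{0, 1}` [folklore] -/
@[folklore] private def edgeZeroOne : Finset (Fin 10) := {0, 1}

/-- an edge of `P` is an independent `2`-set of `P̄` [folklore] -/
@[folklore] private theorem isNIndepSet_compl_edgeZeroOne :
    petersenᶜ.IsNIndepSet 2 edgeZeroOne := by
  rw [← isNClique_compl, compl_compl]
  decide

/-- **`α(P̄) = ω(P) = 2`**: `≥` by an edge, `≤` from `α(P̄) ≤ ϑ(P̄) = 5/2 < 3` (equivalently,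
`P` is triangle-free). [cite: BrouwerHaemers2012, §9.1.1 (iv) (λ = 0) and Proposition 3.7.6] -/
theorem indepNum_petersen_compl : petersenᶜ.indepNum = 2 := by
  refine le_antisymm ?_ ?_
  · have h : (petersenᶜ.indepNum : ℝ) ≤ 5 / 2 :=
      ((indepNum_le_theta petersenᶜ 0).trans (theta_le_lovaszTheta petersenᶜ 0)).trans
        lovaszTheta_petersen_compl.le
    have h' : (petersenᶜ.indepNum : ℝ) < 3 := h.trans_lt (by norm_num)
    have h'' : petersenᶜ.indepNum < 3 := by exact_mod_cast h'
    omega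
  · have h := isNIndepSet_compl_edgeZeroOne.1.card_le_indepNum
    have hc : edgeZeroOne.card = 2 := by decide
    rwa [hc] at h

/-- **`α(P̄) = 2 < 5/2 = ϑ(P̄)`**: for the complement of the Petersen graph (the triangular graph
`T(5)`, the line graph of `K₅`) Lovász's bound is *not* tight. [cite: BrouwerHaemers2012,
Proposition 3.7.6 and §9.1.7 (ii) (T(5))] [cite: Lovasz1979, Theorem 8 (p. 5)] -/
theorem indepNum_lt_lovaszTheta_petersen_compl :
    (petersenᶜ.indepNum : ℝ) < lovaszTheta petersenᶜ := by
  rw [indepNum_petersen_compl, lovaszTheta_petersen_compl]; norm_num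

/-- `2 ≤ ϑ^{(r)}(P̄) ≤ 5/2` for every `r`: the de Klerk–Pasechnik bounds of `P̄` lie in
`[α(P̄), ϑ(P̄)] = [2, 5/2]`. [cite: LaurentVargas2022, §1 (1.5) (sandwich α ≤ ϑ^{(r)} ≤ ϑ' ≤ ϑ)] -/
theorem theta_petersen_compl_mem_Icc (r : ℕ) : theta petersenᶜ r ∈ Set.Icc (2 : ℝ) (5 / 2) := by
  refine ⟨?_, (theta_le_lovaszTheta petersenᶜ r).trans lovaszTheta_petersen_compl.le⟩
  have h := indepNum_le_theta petersenᶜ r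
  rw [indepNum_petersen_compl] at h
  exact_mod_cast h

end Literature.Combinatorics.Optimization.PetersenTheta
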